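import Summits.ValiantsHypothesis.ValiantsHypothesis.Theorems.LacunarySymmetroidMatrixDescartesCensusDoorA34NullTopEighteenAnatomy
import Summits.ValiantsHypothesis.ValiantsHypothesis.Theorems.LacunarySymmetroidMatrixDescartesCensusDoorA34Letters
import Summits.ValiantsHypothesis.ValiantsHypothesis.Theorems.LacunarySymmetroidMatrixDescartesCensusFullAlternation

/-!
# `MatrixDescartes` census — DOOR A at `(3,4)`: the MIDDLE-PAIR DICHOTOMY — a null-top EIGHTEEN (resp. a NINETEEN) alternates at the slot pair
# `{x^{d₃+2d₁}, x^{d₃+d₀+d₂}}` whenever no slot exponent lies strictly between them; the record says every located maximal object does NOT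

HONEST FRAMING.  Object-search cell `pub-symmetroid`, engine seat `val-sym-eng-2` (g10); helper row beside the registered strata line
`Cruxes/DoorA34/Lines/strata.lean` on stmt-ValiantsHypothesis-19980 (`DoorA34 = PosRootLawAt 3 4 18`: OPEN, typed, never asserted here), stub
`stub_nullTopCeiling` (`det S₃ = 0 ⇒ ≤ 17`).  THE LOCATED LAW behind this file (this seat's exact sign-word census of the cell's `(3,4)` records,
`HOME/census/records/3-4.jsonl`, 395 rows, plus the seven sheet objects of the tree and the twelve semidefinite census optima of val-sym-eng-2 g9; report
DOOR-A34-ENG2G10 §3): EVERY located maximal object — all twelve census eighteens (one family, the `(0,1,4,N)` flag rail), the null-top seventeens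
(p584238, p559152), the semidefinite / interleaved / null-null sixteens and fifteen, the twelve semidefinite optima — has EQUAL signs at the two
determinant coefficients of `x^{d₃+2d₁}` (slot `{1,1,3}`, letter datum `tr(adj S₁·S₃)`) and `x^{d₃+d₀+d₂}` (slot `{0,2,3}`, the mixed adjugate
`tr(B(S₀,S₂)·S₃)`), which are adjacent on all those supports; all the sheet objects are moreover Descartes-SHARP for their own word (`Z₊ = V`).  The
census seventeens whose word is FULLY alternating (`V = 19`, the pseudo-nineteen rail `(0,2,5,N)` / `(0,3,7,N)`, 31 rows) stall at `17`.  So, located: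
«a maximal object spends its one lost alternation at the middle pair» — g8's single-slot obstruction `{0,2,3}` read at the sign level and in every regime.

THIS FILE proves the exact Descartes bookkeeping that turns that located law into a dichotomy for the stub (any support `d`, ANY real letters — no
symmetry is needed for this direction):

* `sum_sym_113`, `sum_sym_023` — the two slots as multiset sums (members of the `19`-slot support image on the null-top sheet);
* **`middlePair_alternates_of_nullTop_eighteen`** — `det S₃ = 0`, `18 ≤ Z₊`, and no support exponent strictly between `a = d₃+2d₁` and
  `b = d₃+d₀+d₂` (either order) ⇒ `coeff a · coeff b < 0`: a null-top EIGHTEEN ALTERNATES at the middle pair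
  (`Census.support_det_pencil_eq_of_nullTop_eighteen` + F1 `Census.coeff_mul_coeff_neg_of_sharp`);
* **`posRoots_le_17_of_nullTop_of_middlePair_sameSign`** — contrapositive, the LOCATED SIDE of the dichotomy in stub currency: on the null-top sheet,
  `0 ≤ coeff(d₃+2d₁) · coeff(d₃+d₀+d₂)` with the two exponents adjacent-or-equal in the slot image ⇒ `Z₊ ≤ 17`;
* `middlePair_alternates_of_nineteen` — the door-level companion: a `(3,4)` NINETEEN alternates at the same pair under the same adjacency
  (`Census.support_det_pencil_eq_of_nineteen`).
* §4 (rev 2) LETTER CURRENCY: on a SORTED support a null-top eighteen has `coeff(d₃+2d₁) = tr(adj S₁·S₃)`, `coeff(d₃+d₀+d₂) = tr(B(S₀,S₂)·S₃)`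
  (`B` = mixed adjugate) — `trace_middlePair_neg_of_nullTop_eighteen`; `middlePair_gap_of_window` (`3d₂ ≤ d₃ + 2d₀` ⇒ the pair is adjacent for EVERY pencil on `d`);
  **`posRoots_le_17_of_nullTop_window_of_trace_middlePair_nonneg`** — window-separated sorted support, `det S₃ = 0`,
  `0 ≤ tr(adj S₁·S₃)·tr(B(S₀,S₂)·S₃)` ⇒ `Z₊ ≤ 17` (any real letters).
* §5 (rev 3) `middlePair_gap_of_slots` (the gap as a DECIDABLE slot condition on `d`), `posRoots_le_17_of_nullTop_slots_of_trace_middlePair_nonneg`,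
  and the two interleaved record supports `(0,4,9,16)`, `(0,8,14,23)` by `decide`.

READING.  `stub_nullTopCeiling` on a support whose slot image has nothing strictly between `d₃+2d₁` and `d₃+d₀+d₂` (all window-ordered supports
`d₃ > 2d₂`, and e.g. `(0,4,9,16)`, `(0,8,14,23)`) is therefore EQUIVALENT to: «no null-top pencil with `coeff(d₃+2d₁)·coeff(d₃+d₀+d₂) < 0` has `18`
positive roots» — the located residual is exactly the ALTERNATING middle pair, where the record's best objects are the `V = 19` pseudo-nineteens with
`17` roots.  Nothing here bounds that residual; it is a certificate about hypothetical eighteens.  `DoorA34` and all three stubs stay OPEN; registers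
unchanged (`ζ_sym(3,4) ∈ {18,19}`); nothing on `MatrixDescartes` (stmt-ValiantsHypothesis-18050) or `VP ≠ VNP` — VP≠VNP not moved.
[folklore] Descartes' rule of signs with the full-alternation corollary (tree: `…CensusFullAlternation`), sparse supports; elementary.
-/

-- `Summit.ValiantsHypothesis.ValiantsHypothesis.…` repeats a component by the D-0017 layout
-- (single-conjunct summit), which the `dupNamespace` linter flags; the name is mandated.
set_option linter.dupNamespace false

namespace Summit.ValiantsHypothesis.ValiantsHypothesis.Theorems.LacunarySymmetroidMatrixDescartes.Census

open Polynomial Finset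
open scoped BigOperators Polynomial Matrix

/-! ## 1. The two middle-pair slots as multiset sums -/

/-- The value multiset of `![1, 1, 3]` has exponent `d₃ + 2d₁`. [folklore] -/
theorem sym_sum_113_eq (d : Fin 4 → ℕ) :
    (((⟨Finset.univ.val.map ![1, 1, 3], StubDescartesCeiling.card_map_univ_val ![1, 1, 3]⟩ : Sym (Fin 4) 3) : Multiset (Fin 4)).map d).sum
      = d 3 + 2 * d 1 := by
  have h := sym_sum_of_fun d ![1, 1, 3]
  rw [Fin.sum_univ_three] at h
  simp only [Matrix.cons_val_zero, Matrix.cons_val_one, Matrix.head_cons, Matrix.cons_val_two, Matrix.tail_cons] at h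
  refine h.trans ?_
  ring

/-- The value multiset of `![0, 2, 3]` has exponent `d₃ + d₀ + d₂`. [folklore] -/
theorem sym_sum_023_eq (d : Fin 4 → ℕ) :
    (((⟨Finset.univ.val.map ![0, 2, 3], StubDescartesCeiling.card_map_univ_val ![0, 2, 3]⟩ : Sym (Fin 4) 3) : Multiset (Fin 4)).map d).sum
      = d 3 + d 0 + d 2 := by
  have h := sym_sum_of_fun d ![0, 2, 3]
  rw [Fin.sum_univ_three] at h
  simp only [Matrix.cons_val_zero, Matrix.cons_val_one, Matrix.head_cons, Matrix.cons_val_two, Matrix.tail_cons] at h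
  refine h.trans ?_
  ring

/-- The slot `{1,1,3}` is not the top cube. [folklore] -/
theorem sym_113_ne_replicate :
    (⟨Finset.univ.val.map ![1, 1, 3], StubDescartesCeiling.card_map_univ_val ![1, 1, 3]⟩ : Sym (Fin 4) 3) ≠ Sym.replicate 3 3 :=
  fun h => absurd (fun_const_of_sym_eq_replicate ![1, 1, 3] 3 h 0) (by decide)

/-- The slot `{0,2,3}` is not the top cube. [folklore] -/
theorem sym_023_ne_replicate :
    (⟨Finset.univ.val.map ![0, 2, 3], StubDescartesCeiling.card_map_univ_val ![0, 2, 3]⟩ : Sym (Fin 4) 3) ≠ Sym.replicate 3 3 :=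
  fun h => absurd (fun_const_of_sym_eq_replicate ![0, 2, 3] 3 h 0) (by decide)

/-- The slot `{1,1,3}` has exponent `d₃ + 2d₁` in the `19`-slot image of the null-top sheet. [folklore] -/
theorem sum_sym_113 (d : Fin 4 → ℕ) :
    d 3 + 2 * d 1 ∈ ((Finset.univ : Finset (Sym (Fin 4) 3)).erase (Sym.replicate 3 3)).image
        (fun s : Sym (Fin 4) 3 => ((s : Multiset (Fin 4)).map d).sum) :=
  Finset.mem_image.mpr ⟨_, Finset.mem_erase.mpr ⟨sym_113_ne_replicate, Finset.mem_univ _⟩, sym_sum_113_eq d⟩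

/-- The slot `{0,2,3}` has exponent `d₃ + d₀ + d₂` in the `19`-slot image of the null-top sheet. [folklore] -/
theorem sum_sym_023 (d : Fin 4 → ℕ) :
    d 3 + d 0 + d 2 ∈ ((Finset.univ : Finset (Sym (Fin 4) 3)).erase (Sym.replicate 3 3)).image
        (fun s : Sym (Fin 4) 3 => ((s : Multiset (Fin 4)).map d).sum) :=
  Finset.mem_image.mpr ⟨_, Finset.mem_erase.mpr ⟨sym_023_ne_replicate, Finset.mem_univ _⟩, sym_sum_023_eq d⟩

/-- The two slots are different multisets. [folklore] -/
theorem sym_113_ne_023 :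
    (⟨Finset.univ.val.map ![1, 1, 3], StubDescartesCeiling.card_map_univ_val ![1, 1, 3]⟩ : Sym (Fin 4) 3)
      ≠ (⟨Finset.univ.val.map ![0, 2, 3], StubDescartesCeiling.card_map_univ_val ![0, 2, 3]⟩ : Sym (Fin 4) 3) := by
  intro heqs
  have hfun := congrArg (fun s : Sym (Fin 4) 3 => (s : Multiset (Fin 4))) heqs
  have hmem : (0 : Fin 4) ∈ (Finset.univ.val.map ![0, 2, 3] : Multiset (Fin 4)) :=
    Multiset.mem_map_of_mem _ (Finset.mem_univ_val (0 : Fin 3))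
  have hmem' : (0 : Fin 4) ∈ (Finset.univ.val.map ![1, 1, 3] : Multiset (Fin 4)) := by
    have : (Finset.univ.val.map ![1, 1, 3] : Multiset (Fin 4)) = (Finset.univ.val.map ![0, 2, 3] : Multiset (Fin 4)) := hfun
    rw [this]; exact hmem
  obtain ⟨i, -, hi⟩ := Multiset.mem_map.mp hmem'
  fin_cases i <;> simp at hi

/-! ## 2. A null-top eighteen alternates at the middle pair -/

/-- Generic step: a null-top eighteen is Descartes-sharp, so two support exponents with nothing of the support strictly between them carry
coefficients of opposite signs. [folklore] -/
theorem coeff_mul_coeff_neg_of_nullTop_eighteen (d : Fin 4 → ℕ) (S : Fin 4 → Matrix (Fin 3) (Fin 3) ℝ) (h3 : (S 3).det = 0)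
    (h18 : 18 ≤ ((Matrix.det (∑ l, ((X : ℝ[X]) ^ d l) • (S l).map C)).roots.toFinset.filter (fun t => 0 < t)).card)
    {a b : ℕ} (ha : a ∈ (Matrix.det (∑ l, ((X : ℝ[X]) ^ d l) • (S l).map C)).support)
    (hb : b ∈ (Matrix.det (∑ l, ((X : ℝ[X]) ^ d l) • (S l).map C)).support) (hab : a < b)
    (hgap : ∀ c ∈ (Matrix.det (∑ l, ((X : ℝ[X]) ^ d l) • (S l).map C)).support, ¬ (a < c ∧ c < b)) :
    (Matrix.det (∑ l, ((X : ℝ[X]) ^ d l) • (S l).map C)).coeff a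
      * (Matrix.det (∑ l, ((X : ℝ[X]) ^ d l) • (S l).map C)).coeff b < 0 := by
  have hcard := card_support_le_19_of_nullTop d S h3
  exact coeff_mul_coeff_neg_of_sharp _ (by omega) ha hb hab hgap

/-- **A NULL-TOP EIGHTEEN ALTERNATES AT THE MIDDLE PAIR.**  For any support `d` and ANY real `3 × 3` letters with `det S₃ = 0`: if the pencil
determinant has `18` distinct positive roots and no exponent of its support lies strictly between `d₃ + 2d₁` and `d₃ + d₀ + d₂`, then the two
coefficients there have OPPOSITE signs (in particular the two exponents differ).  Located (this seat): every record object of the sheet has them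
EQUAL in sign. [folklore] -/
theorem middlePair_alternates_of_nullTop_eighteen (d : Fin 4 → ℕ) (S : Fin 4 → Matrix (Fin 3) (Fin 3) ℝ) (h3 : (S 3).det = 0)
    (h18 : 18 ≤ ((Matrix.det (∑ l, ((X : ℝ[X]) ^ d l) • (S l).map C)).roots.toFinset.filter (fun t => 0 < t)).card)
    (hgap : ∀ c ∈ (Matrix.det (∑ l, ((X : ℝ[X]) ^ d l) • (S l).map C)).support,
      ¬ (min (d 3 + 2 * d 1) (d 3 + d 0 + d 2) < c ∧ c < max (d 3 + 2 * d 1) (d 3 + d 0 + d 2))) :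
    (Matrix.det (∑ l, ((X : ℝ[X]) ^ d l) • (S l).map C)).coeff (d 3 + 2 * d 1)
      * (Matrix.det (∑ l, ((X : ℝ[X]) ^ d l) • (S l).map C)).coeff (d 3 + d 0 + d 2) < 0 := by
  have hsupp := support_det_pencil_eq_of_nullTop_eighteen d S h3 h18
  have ha : d 3 + 2 * d 1 ∈ (Matrix.det (∑ l, ((X : ℝ[X]) ^ d l) • (S l).map C)).support := by rw [hsupp]; exact sum_sym_113 d
  have hb : d 3 + d 0 + d 2 ∈ (Matrix.det (∑ l, ((X : ℝ[X]) ^ d l) • (S l).map C)).support := by rw [hsupp]; exact sum_sym_023 d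
  -- the two slots are distinct exponents (injectivity of the slot map at `18` roots)
  have hinj := sym_sum_injOn_of_nullTop_eighteen d S h3 h18
  have hne : d 3 + 2 * d 1 ≠ d 3 + d 0 + d 2 := by
    intro heq
    refine sym_113_ne_023 (hinj (Finset.mem_coe.mpr (Finset.mem_erase.mpr ⟨sym_113_ne_replicate, Finset.mem_univ _⟩))
      (Finset.mem_coe.mpr (Finset.mem_erase.mpr ⟨sym_023_ne_replicate, Finset.mem_univ _⟩)) ?_)
    exact (sym_sum_113_eq d).trans (heq.trans (sym_sum_023_eq d).symm)
  rcases lt_or_gt_of_ne hne with hlt | hgt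
  · refine coeff_mul_coeff_neg_of_nullTop_eighteen d S h3 h18 ha hb hlt fun c hc hc' => hgap c hc ?_
    rw [min_eq_left hlt.le, max_eq_right hlt.le]; exact hc'
  · have h := coeff_mul_coeff_neg_of_nullTop_eighteen d S h3 h18 hb ha hgt fun c hc hc' => hgap c hc (by
      rw [min_eq_right hgt.le, max_eq_left hgt.le]; exact hc')
    linarith [h]

/-- **THE LOCATED SIDE OF THE DICHOTOMY, in stub currency.**  On the null-top sheet (`det S₃ = 0`, any support, any real letters): if the determinant
coefficients at `d₃+2d₁` and `d₃+d₀+d₂` have a non-negative product (equal signs, or one of them zero, or coincident exponents) and no support exponent lies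
strictly between the two exponents, then `Z₊ ≤ 17`.  This is the situation of EVERY record object of the sheet (located, this seat); the open residual
of `stub_nullTopCeiling` on such supports is the alternating middle pair. [folklore] -/
theorem posRoots_le_17_of_nullTop_of_middlePair_sameSign (d : Fin 4 → ℕ) (S : Fin 4 → Matrix (Fin 3) (Fin 3) ℝ) (h3 : (S 3).det = 0)
    (hgap : ∀ c ∈ (Matrix.det (∑ l, ((X : ℝ[X]) ^ d l) • (S l).map C)).support,
      ¬ (min (d 3 + 2 * d 1) (d 3 + d 0 + d 2) < c ∧ c < max (d 3 + 2 * d 1) (d 3 + d 0 + d 2)))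
    (hsign : 0 ≤ (Matrix.det (∑ l, ((X : ℝ[X]) ^ d l) • (S l).map C)).coeff (d 3 + 2 * d 1)
      * (Matrix.det (∑ l, ((X : ℝ[X]) ^ d l) • (S l).map C)).coeff (d 3 + d 0 + d 2)) :
    ((Matrix.det (∑ l, ((X : ℝ[X]) ^ d l) • (S l).map C)).roots.toFinset.filter (fun t => 0 < t)).card ≤ 17 := by
  by_contra hlt
  have h18 : 18 ≤ ((Matrix.det (∑ l, ((X : ℝ[X]) ^ d l) • (S l).map C)).roots.toFinset.filter (fun t => 0 < t)).card := by omega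
  have h := middlePair_alternates_of_nullTop_eighteen d S h3 h18 hgap
  linarith

/-! ## 3. The door-level companion: a nineteen alternates at the middle pair -/

/-- **A NINETEEN ALTERNATES AT THE MIDDLE PAIR** (any support, any real letters): `19` distinct positive det-roots and no support exponent strictly
between `d₃+2d₁` and `d₃+d₀+d₂` (assumed different) ⇒ the two coefficients have opposite signs.  Located (this seat): all twelve census eighteens
have them EQUAL; the thirty-one census seventeens with a fully alternating word (the `(0,2,5,N)` / `(0,3,7,N)` pseudo-nineteen rail) have them
opposite and stall at `17`. [folklore] -/
theorem middlePair_alternates_of_nineteen (d : Fin 4 → ℕ) (S : Fin 4 → Matrix (Fin 3) (Fin 3) ℝ)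
    (h19 : 19 ≤ ((Matrix.det (∑ l, ((X : ℝ[X]) ^ d l) • (S l).map C)).roots.toFinset.filter (fun t => 0 < t)).card)
    (hne : d 3 + 2 * d 1 ≠ d 3 + d 0 + d 2)
    (hgap : ∀ c ∈ (Matrix.det (∑ l, ((X : ℝ[X]) ^ d l) • (S l).map C)).support,
      ¬ (min (d 3 + 2 * d 1) (d 3 + d 0 + d 2) < c ∧ c < max (d 3 + 2 * d 1) (d 3 + d 0 + d 2))) :
    (Matrix.det (∑ l, ((X : ℝ[X]) ^ d l) • (S l).map C)).coeff (d 3 + 2 * d 1)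
      * (Matrix.det (∑ l, ((X : ℝ[X]) ^ d l) • (S l).map C)).coeff (d 3 + d 0 + d 2) < 0 := by
  have hsupp := support_det_pencil_eq_of_nineteen d S h19
  have ha : d 3 + 2 * d 1 ∈ (Matrix.det (∑ l, ((X : ℝ[X]) ^ d l) • (S l).map C)).support := by
    rw [hsupp]; exact Finset.mem_image.mpr ⟨_, Finset.mem_univ _, sym_sum_113_eq d⟩
  have hb : d 3 + d 0 + d 2 ∈ (Matrix.det (∑ l, ((X : ℝ[X]) ^ d l) • (S l).map C)).support := by
    rw [hsupp]; exact Finset.mem_image.mpr ⟨_, Finset.mem_univ _, sym_sum_023_eq d⟩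
  have hcard : (Matrix.det (∑ l, ((X : ℝ[X]) ^ d l) • (S l).map C)).support.card ≤ 20 := by
    rw [hsupp]
    refine Finset.card_image_le.trans ?_
    rw [Finset.card_univ, Sym.card_sym_eq_choose]; decide
  rcases lt_or_gt_of_ne hne with hlt | hgt
  · exact coeff_mul_coeff_neg_of_sharp _ (by omega) ha hb hlt fun c hc hc' => hgap c hc (by
      rw [min_eq_left hlt.le, max_eq_right hlt.le]; exact hc')
  · have h := coeff_mul_coeff_neg_of_sharp _ (by omega) hb ha hgt fun c hc hc' => hgap c hc (by
      rw [min_eq_right hgt.le, max_eq_left hgt.le]; exact hc')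
    linarith [h]

/-! ## 4. (rev 2) The middle pair in LETTER currency, and the window-separated supports -/

/-- On a sorted null-top support with `18` roots, the coefficient at `d₃ + 2d₁` IS `tr(adj S₁ · S₃)` (the slot `{1,1,3}` is uniquely represented,
`Census.sym_eq_of_sum_eq_of_nullTop_eighteen` + the dictionary `Census.coeff_det_pencil_three_square`). [folklore] -/
theorem coeff_middle113_eq_of_nullTop_eighteen (d : Fin 4 → ℕ) (hd : StrictMono d) (S : Fin 4 → Matrix (Fin 3) (Fin 3) ℝ)
    (h3 : (S 3).det = 0)
    (h18 : 18 ≤ ((Matrix.det (∑ l, ((X : ℝ[X]) ^ d l) • (S l).map C)).roots.toFinset.filter (fun t => 0 < t)).card) :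
    (Matrix.det (∑ l, ((X : ℝ[X]) ^ d l) • (S l).map C)).coeff (d 3 + 2 * d 1) = ((S 1).adjugate * S 3).trace := by
  set s : Sym (Fin 4) 3 := ⟨{1, 1, 3}, by simp⟩ with hsdef
  have hs : s ≠ Sym.replicate 3 (3 : Fin 4) := by
    intro h
    have hmem : (1 : Fin 4) ∈ (s : Multiset (Fin 4)) := by simp [hsdef]
    rw [h, Sym.coe_replicate] at hmem
    exact absurd (Multiset.eq_of_mem_replicate hmem) (by decide)
  have hσ : ((s : Multiset (Fin 4)).map d).sum = 2 * d 1 + d 3 := by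
    simp only [hsdef, Sym.coe_mk, Multiset.insert_eq_cons, Multiset.map_cons, Multiset.sum_cons, Multiset.map_singleton,
      Multiset.sum_singleton]
    ring
  have huniq : ∀ f : Fin 3 → Fin 4, (∑ t, d (f t)) = 2 * d 1 + d 3 → f = ![1, 1, 3] ∨ f = ![1, 3, 1] ∨ f = ![3, 1, 1] := by
    intro f hf
    have h := sym_eq_of_sum_eq_of_nullTop_eighteen d hd S h3 h18 s hs f (hf.trans hσ.symm)
    have hval : (Finset.univ.val.map f : Multiset (Fin 4)) = {1, 1, 3} := by
      have := congrArg (fun u : Sym (Fin 4) 3 => (u : Multiset (Fin 4))) h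
      simpa [hsdef] using this
    exact fun_eq_of_map_univ_eq_pair 1 3 (by decide) f hval
  rw [show d 3 + 2 * d 1 = 2 * d 1 + d 3 by ring]
  exact coeff_det_pencil_three_square d S (by decide) huniq

/-- On a sorted null-top support with `18` roots, the coefficient at `d₃ + d₀ + d₂` IS the mixed adjugate `tr((adj(S₀+S₂) − adj S₀ − adj S₂)·S₃)`. [folklore] -/
theorem coeff_middle023_eq_of_nullTop_eighteen (d : Fin 4 → ℕ) (hd : StrictMono d) (S : Fin 4 → Matrix (Fin 3) (Fin 3) ℝ)
    (h3 : (S 3).det = 0)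
    (h18 : 18 ≤ ((Matrix.det (∑ l, ((X : ℝ[X]) ^ d l) • (S l).map C)).roots.toFinset.filter (fun t => 0 < t)).card) :
    (Matrix.det (∑ l, ((X : ℝ[X]) ^ d l) • (S l).map C)).coeff (d 3 + d 0 + d 2)
      = (((S 0 + S 2).adjugate - (S 0).adjugate - (S 2).adjugate) * S 3).trace := by
  set s : Sym (Fin 4) 3 := ⟨{0, 2, 3}, by simp⟩ with hsdef
  have hs : s ≠ Sym.replicate 3 (3 : Fin 4) := by
    intro h
    have hmem : (0 : Fin 4) ∈ (s : Multiset (Fin 4)) := by simp [hsdef]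
    rw [h, Sym.coe_replicate] at hmem
    exact absurd (Multiset.eq_of_mem_replicate hmem) (by decide)
  have hσ : ((s : Multiset (Fin 4)).map d).sum = d 0 + d 2 + d 3 := by
    simp only [hsdef, Sym.coe_mk, Multiset.insert_eq_cons, Multiset.map_cons, Multiset.sum_cons, Multiset.map_singleton,
      Multiset.sum_singleton]
    ring
  have huniq : ∀ f : Fin 3 → Fin 4, (∑ t, d (f t)) = d 0 + d 2 + d 3 →
      f = ![0, 2, 3] ∨ f = ![0, 3, 2] ∨ f = ![2, 0, 3] ∨ f = ![2, 3, 0] ∨ f = ![3, 0, 2] ∨ f = ![3, 2, 0] := by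
    intro f hf
    have h := sym_eq_of_sum_eq_of_nullTop_eighteen d hd S h3 h18 s hs f (hf.trans hσ.symm)
    have hval : (Finset.univ.val.map f : Multiset (Fin 4)) = {0, 2, 3} := by
      have := congrArg (fun u : Sym (Fin 4) 3 => (u : Multiset (Fin 4))) h
      simpa [hsdef] using this
    exact fun_eq_of_map_univ_eq_triple 0 2 3 (by decide) (by decide) (by decide) f hval
  rw [show d 3 + d 0 + d 2 = d 0 + d 2 + d 3 by ring]
  exact coeff_det_pencil_three_mixed d S (by decide) (by decide) (by decide) huniq

/-- **THE MIDDLE PAIR IN LETTER CURRENCY.**  Sorted support, `det S₃ = 0`, `18` distinct positive roots and no support exponent strictly between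
`d₃+2d₁` and `d₃+d₀+d₂` ⇒ `tr(adj S₁·S₃) · tr((adj(S₀+S₂) − adj S₀ − adj S₂)·S₃) < 0` (ANY real letters). [folklore] -/
theorem trace_middlePair_neg_of_nullTop_eighteen (d : Fin 4 → ℕ) (hd : StrictMono d) (S : Fin 4 → Matrix (Fin 3) (Fin 3) ℝ)
    (h3 : (S 3).det = 0)
    (h18 : 18 ≤ ((Matrix.det (∑ l, ((X : ℝ[X]) ^ d l) • (S l).map C)).roots.toFinset.filter (fun t => 0 < t)).card)
    (hgap : ∀ c ∈ (Matrix.det (∑ l, ((X : ℝ[X]) ^ d l) • (S l).map C)).support,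
      ¬ (min (d 3 + 2 * d 1) (d 3 + d 0 + d 2) < c ∧ c < max (d 3 + 2 * d 1) (d 3 + d 0 + d 2))) :
    ((S 1).adjugate * S 3).trace * (((S 0 + S 2).adjugate - (S 0).adjugate - (S 2).adjugate) * S 3).trace < 0 := by
  rw [← coeff_middle113_eq_of_nullTop_eighteen d hd S h3 h18, ← coeff_middle023_eq_of_nullTop_eighteen d hd S h3 h18]
  exact middlePair_alternates_of_nullTop_eighteen d S h3 h18 hgap

/-- **WINDOW-SEPARATED SUPPORTS HAVE THE GAP.**  On a sorted support with `3·d₂ ≤ d₃ + 2·d₀` (the core block ends before the middle block begins: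
every `(0,1,4,N)`, `N ≥ 12`, every `(0,2,5,N)`, `N ≥ 15`, …) no triple sum `d_i + d_j + d_k` lies strictly between `d₃ + 2d₁` and `d₃ + d₀ + d₂`;
hence no support exponent of ANY `(3,4)` pencil determinant on `d` does. [folklore] -/
theorem middlePair_gap_of_window (d : Fin 4 → ℕ) (hd : StrictMono d) (hwin : 3 * d 2 ≤ d 3 + 2 * d 0)
    (S : Fin 4 → Matrix (Fin 3) (Fin 3) ℝ) :
    ∀ c ∈ (Matrix.det (∑ l, ((X : ℝ[X]) ^ d l) • (S l).map C)).support,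
      ¬ (min (d 3 + 2 * d 1) (d 3 + d 0 + d 2) < c ∧ c < max (d 3 + 2 * d 1) (d 3 + d 0 + d 2)) := by
  intro c hc hbetween
  have h01 : d 0 < d 1 := hd (by decide)
  have h12 : d 1 < d 2 := hd (by decide)
  have h23 : d 2 < d 3 := hd (by decide)
  -- some row-to-letter map realises `c`
  have hne : (Matrix.det (∑ l, ((X : ℝ[X]) ^ d l) • (S l).map C)).coeff c ≠ 0 := Polynomial.mem_support_iff.mp hc
  apply hne
  refine StubDescartesCeiling.coeff_det_pencil_eq_zero d S fun f hf => ?_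
  rw [Fin.sum_univ_three] at hf
  obtain ⟨a, ha⟩ : ∃ a, f 0 = a := ⟨_, rfl⟩
  obtain ⟨b, hb⟩ : ∃ b, f 1 = b := ⟨_, rfl⟩
  obtain ⟨e, he⟩ : ∃ e, f 2 = e := ⟨_, rfl⟩
  rw [ha, hb, he] at hf
  rcases lt_or_ge (d 3 + 2 * d 1) (d 3 + d 0 + d 2) with hlt | hge
  · rw [min_eq_left hlt.le, max_eq_right hlt.le] at hbetween
    fin_cases a <;> fin_cases b <;> fin_cases e <;> simp at hf <;> omega
  · rw [min_eq_right hge, max_eq_left hge] at hbetween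
    fin_cases a <;> fin_cases b <;> fin_cases e <;> simp at hf <;> omega

/-- **THE LOCATED SIDE OF THE DICHOTOMY, letter currency, window-separated supports.**  Sorted support with `3·d₂ ≤ d₃ + 2·d₀`, `det S₃ = 0`, and
`0 ≤ tr(adj S₁·S₃) · tr((adj(S₀+S₂) − adj S₀ − adj S₂)·S₃)` ⇒ `Z₊ ≤ 17` — ANY real letters.  (Located, this seat: every window object of record has the
product POSITIVE; the open residual of `stub_nullTopCeiling` on these supports is the negative product.) [folklore] -/
theorem posRoots_le_17_of_nullTop_window_of_trace_middlePair_nonneg (d : Fin 4 → ℕ) (hd : StrictMono d) (hwin : 3 * d 2 ≤ d 3 + 2 * d 0)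
    (S : Fin 4 → Matrix (Fin 3) (Fin 3) ℝ) (h3 : (S 3).det = 0)
    (hsign : 0 ≤ ((S 1).adjugate * S 3).trace * (((S 0 + S 2).adjugate - (S 0).adjugate - (S 2).adjugate) * S 3).trace) :
    ((Matrix.det (∑ l, ((X : ℝ[X]) ^ d l) • (S l).map C)).roots.toFinset.filter (fun t => 0 < t)).card ≤ 17 := by
  by_contra hlt
  have h18 : 18 ≤ ((Matrix.det (∑ l, ((X : ℝ[X]) ^ d l) • (S l).map C)).roots.toFinset.filter (fun t => 0 < t)).card := by omega
  have h := trace_middlePair_neg_of_nullTop_eighteen d hd S h3 h18 (middlePair_gap_of_window d hd hwin S)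
  linarith

/-- **A window-separated null-top EIGHTEEN has `tr(adj S₁·S₃) · tr(B(S₀,S₂)·S₃) < 0`** (sorted support, `3·d₂ ≤ d₃ + 2·d₀`, any real letters). [folklore] -/
theorem trace_middlePair_neg_of_nullTop_eighteen_window (d : Fin 4 → ℕ) (hd : StrictMono d) (hwin : 3 * d 2 ≤ d 3 + 2 * d 0)
    (S : Fin 4 → Matrix (Fin 3) (Fin 3) ℝ) (h3 : (S 3).det = 0)
    (h18 : 18 ≤ ((Matrix.det (∑ l, ((X : ℝ[X]) ^ d l) • (S l).map C)).roots.toFinset.filter (fun t => 0 < t)).card) :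
    ((S 1).adjugate * S 3).trace * (((S 0 + S 2).adjugate - (S 0).adjugate - (S 2).adjugate) * S 3).trace < 0 :=
  trace_middlePair_neg_of_nullTop_eighteen d hd S h3 h18 (middlePair_gap_of_window d hd hwin S)

/-! ## 5. (rev 3) The gap as a DECIDABLE condition on the support: interleaved supports with an adjacent middle pair -/

/-- If no row-to-letter map has exponent strictly between `d₃+2d₁` and `d₃+d₀+d₂` — a condition on `d` alone, decidable by `decide` for a numeric
support — then no support exponent of any `(3,4)` pencil determinant on `d` lies strictly between them. [folklore] -/
theorem middlePair_gap_of_slots (d : Fin 4 → ℕ)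
    (hslots : ∀ f : Fin 3 → Fin 4, ¬ (min (d 3 + 2 * d 1) (d 3 + d 0 + d 2) < ∑ i, d (f i) ∧ ∑ i, d (f i) < max (d 3 + 2 * d 1) (d 3 + d 0 + d 2)))
    (S : Fin 4 → Matrix (Fin 3) (Fin 3) ℝ) :
    ∀ c ∈ (Matrix.det (∑ l, ((X : ℝ[X]) ^ d l) • (S l).map C)).support,
      ¬ (min (d 3 + 2 * d 1) (d 3 + d 0 + d 2) < c ∧ c < max (d 3 + 2 * d 1) (d 3 + d 0 + d 2)) := by
  intro c hc hbetween
  apply Polynomial.mem_support_iff.mp hc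
  refine StubDescartesCeiling.coeff_det_pencil_eq_zero d S fun f hf => ?_
  exact hslots f (hf ▸ hbetween)

/-- **THE LOCATED SIDE, any support with an adjacent middle pair** (sorted `d`, the slot condition of `middlePair_gap_of_slots`, `det S₃ = 0`,
`0 ≤ tr(adj S₁·S₃)·tr(B(S₀,S₂)·S₃)` ⇒ `Z₊ ≤ 17`; any real letters). [folklore] -/
theorem posRoots_le_17_of_nullTop_slots_of_trace_middlePair_nonneg (d : Fin 4 → ℕ) (hd : StrictMono d)
    (hslots : ∀ f : Fin 3 → Fin 4, ¬ (min (d 3 + 2 * d 1) (d 3 + d 0 + d 2) < ∑ i, d (f i) ∧ ∑ i, d (f i) < max (d 3 + 2 * d 1) (d 3 + d 0 + d 2)))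
    (S : Fin 4 → Matrix (Fin 3) (Fin 3) ℝ) (h3 : (S 3).det = 0)
    (hsign : 0 ≤ ((S 1).adjugate * S 3).trace * (((S 0 + S 2).adjugate - (S 0).adjugate - (S 2).adjugate) * S 3).trace) :
    ((Matrix.det (∑ l, ((X : ℝ[X]) ^ d l) • (S l).map C)).roots.toFinset.filter (fun t => 0 < t)).card ≤ 17 := by
  by_contra hlt
  have h18 : 18 ≤ ((Matrix.det (∑ l, ((X : ℝ[X]) ^ d l) • (S l).map C)).roots.toFinset.filter (fun t => 0 < t)).card := by omega
  have h := trace_middlePair_neg_of_nullTop_eighteen d hd S h3 h18 (middlePair_gap_of_slots d hslots S)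
  linarith

/-- The interleaved record support `(0,4,9,16)` (the sixteen `…CensusDoorA34NullTopSixteen04916`): middle pair `(24, 25)`, adjacent. [folklore] -/
theorem middlePair_slots_0_4_9_16 :
    ∀ f : Fin 3 → Fin 4, ¬ (min ((![0, 4, 9, 16] : Fin 4 → ℕ) 3 + 2 * (![0, 4, 9, 16] : Fin 4 → ℕ) 1)
        ((![0, 4, 9, 16] : Fin 4 → ℕ) 3 + (![0, 4, 9, 16] : Fin 4 → ℕ) 0 + (![0, 4, 9, 16] : Fin 4 → ℕ) 2) < ∑ i, (![0, 4, 9, 16] : Fin 4 → ℕ) (f i)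
      ∧ ∑ i, (![0, 4, 9, 16] : Fin 4 → ℕ) (f i) < max ((![0, 4, 9, 16] : Fin 4 → ℕ) 3 + 2 * (![0, 4, 9, 16] : Fin 4 → ℕ) 1)
        ((![0, 4, 9, 16] : Fin 4 → ℕ) 3 + (![0, 4, 9, 16] : Fin 4 → ℕ) 0 + (![0, 4, 9, 16] : Fin 4 → ℕ) 2)) := by
  decide

/-- The null-null record support `(0,8,14,23)` (the fifteen `…CensusDoorA34NullNullFifteen`): middle pair `(37, 39)`, `38` is no slot. [folklore] -/
theorem middlePair_slots_0_8_14_23 :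
    ∀ f : Fin 3 → Fin 4, ¬ (min ((![0, 8, 14, 23] : Fin 4 → ℕ) 3 + 2 * (![0, 8, 14, 23] : Fin 4 → ℕ) 1)
        ((![0, 8, 14, 23] : Fin 4 → ℕ) 3 + (![0, 8, 14, 23] : Fin 4 → ℕ) 0 + (![0, 8, 14, 23] : Fin 4 → ℕ) 2) < ∑ i, (![0, 8, 14, 23] : Fin 4 → ℕ) (f i)
      ∧ ∑ i, (![0, 8, 14, 23] : Fin 4 → ℕ) (f i) < max ((![0, 8, 14, 23] : Fin 4 → ℕ) 3 + 2 * (![0, 8, 14, 23] : Fin 4 → ℕ) 1)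
        ((![0, 8, 14, 23] : Fin 4 → ℕ) 3 + (![0, 8, 14, 23] : Fin 4 → ℕ) 0 + (![0, 8, 14, 23] : Fin 4 → ℕ) 2)) := by
  decide

/-- **On `(0,4,9,16)`**: `det S₃ = 0 ∧ 0 ≤ tr(adj S₁·S₃)·tr(B(S₀,S₂)·S₃) ⇒ Z₊ ≤ 17` (any real letters; the record sixteen has the product positive). [folklore] -/
theorem posRoots_le_17_of_nullTop_on_0_4_9_16_of_trace_middlePair_nonneg (S : Fin 4 → Matrix (Fin 3) (Fin 3) ℝ) (h3 : (S 3).det = 0)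
    (hsign : 0 ≤ ((S 1).adjugate * S 3).trace * (((S 0 + S 2).adjugate - (S 0).adjugate - (S 2).adjugate) * S 3).trace) :
    ((Matrix.det (∑ l, ((X : ℝ[X]) ^ (![0, 4, 9, 16] : Fin 4 → ℕ) l) • (S l).map C)).roots.toFinset.filter (fun t => 0 < t)).card ≤ 17 :=
  posRoots_le_17_of_nullTop_slots_of_trace_middlePair_nonneg _
    (by rw [Fin.strictMono_iff_lt_succ]; intro i; fin_cases i <;> decide) middlePair_slots_0_4_9_16 S h3 hsign

/-- **On `(0,8,14,23)`**: `det S₃ = 0 ∧ 0 ≤ tr(adj S₁·S₃)·tr(B(S₀,S₂)·S₃) ⇒ Z₊ ≤ 17` (any real letters). [folklore] -/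
theorem posRoots_le_17_of_nullTop_on_0_8_14_23_of_trace_middlePair_nonneg (S : Fin 4 → Matrix (Fin 3) (Fin 3) ℝ) (h3 : (S 3).det = 0)
    (hsign : 0 ≤ ((S 1).adjugate * S 3).trace * (((S 0 + S 2).adjugate - (S 0).adjugate - (S 2).adjugate) * S 3).trace) :
    ((Matrix.det (∑ l, ((X : ℝ[X]) ^ (![0, 8, 14, 23] : Fin 4 → ℕ) l) • (S l).map C)).roots.toFinset.filter (fun t => 0 < t)).card ≤ 17 :=
  posRoots_le_17_of_nullTop_slots_of_trace_middlePair_nonneg _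
    (by rw [Fin.strictMono_iff_lt_succ]; intro i; fin_cases i <;> decide) middlePair_slots_0_8_14_23 S h3 hsign

end Summit.ValiantsHypothesis.ValiantsHypothesis.Theorems.LacunarySymmetroidMatrixDescartes.Census
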